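/-
Copyright: statement-level skeleton of a published paper (lit-balaban cell, Phase-2 proof seat p27 gen 30). No proof claims
beyond what the kernel checks below.
-/
import Literature.MathematicalPhysics.QuantumFieldTheory.Balaban1983to89.B3Eq322PositiveDegree

/-!
# B3 — T. Bałaban, *(Higgs)₂,₃ quantum fields in a finite volume. III. Renormalization*, CMP **88** (1983) 411–445
[Balaban1983Higgs3], p. 438 [PDF 28]: **"ηG_k(x,x) is convergent to some finite constant as η → 0"** and the first graph of
**(3.21)** — the **`d = 2` INSTANCE** at the zero-field torus model (`A = B̃ = 0`, `Ω = T_η`): in `d = 2` the constant is `0`,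
`|ηG^η_k(x,x)| ≤ C·k·η → 0` uniformly in the volume (the `(Higgs)₂` twin of p20 g8's `d = 3` file `B3GkTadpoleLimitZeroTorus`, whose
limit is the non-zero `K₃`, and of p18 g8's `B3Eq322PositiveDegree.expr321a_zero_torus`).  File 1 of 2 of the `d = 2` instances of row
B3.Eq3.21-3.24; file 2 `B3Eq322ZeroTorusTwoDim` ((3.22)/(3.23) in `d = 2`) imports it.

statement-level skeleton of published theorems with citation tags; proofs where landed; nothing here is a claim about
the Yang–Mills mass gap

PDF held: `paper:balaban1983-higgs-2-3-quantum-fields-finite-volume` (journal page = PDF page + 410); p. 438 [PDF 28] read in the OCR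
text (`p0028.txt`); pp. 422–423 [PDF 12–13] ((2.1)–(2.2), the degree) through rows B3.Eq2.1 / B3.Eq2.2-2.3 of
`HOME/lit-balaban-r15/ROWS-B3.md`; p. 412 [PDF 2] ((1.1) `η = L^{−k}`) as read in p20 g8's file.

CITATION HEADER (lean-in-tree rule).  Part of the lit-balaban TYPED SKELETON (HOME `run/shared/lean/pub/lit-balaban/`), PHASE 2,
seat p27 generation 30 (free-target protocol G.5-34(d); item 2 of §5 of the fold owner's `lit-balaban-r15/B3-CLOSURE.md` v1.0:
*"d = 2 instances of (3.22)/(3.23) and of the p. 438 tadpole sentence"*).  WHAT IS REPRODUCED: row **B3.Eq3.21-3.24** of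
`HOME/lit-balaban-r15/ROWS-B3.md` (fold owner r15, referee ref-4), the p. 438 tadpole sentence and graph (a) of (3.21), zero-field
torus members, `d = 2`.  CONSUMES BY NAME, nothing re-proved: p20 g5's `B3Sect3KernelsZeroTorus.gpiece`/`gpiece_bounds` (the scale
pieces `G^η_{(j)}` of the zero-field torus tower with their (2.10)-type bounds, EVERY `d`), p18 g8's `B3Eq322OneLegDifferentiated`
(`expr321a`, `expr321a_finset_sum`, `abs_expr321a_le`), r15's `B3Sect3ScalarSelfEnergy.d1Kernel`, p39 g6's `B3GkZeroTorusRescaled.G0xi`,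
p20 g6's `B3Eq317ZeroTorus.G0xi_eq_rescaled`/`sum_gpiece_apply`, Mathlib's `tendsto_self_mul_const_pow_of_lt_one`.

THE PRINTED TEXT (verbatim, p. 438).  *"We have to consider another class of graphs with two external scalar field legs, the graphs
with one leg differentiated. There are only two such graphs: (3.21) The expression corresponding to the first graph is in fact
convergent, because ηG_k(x,x) is convergent to some finite constant as η → 0."*  The paper is written for `d = 2, 3` throughout (title;
(2.1) p. 422 *"−(d−2)/2"*).  As in p20 g8's file, `η = L^{−k}` ((1.1) p. 412), so *"η → 0"* is read on Bałaban's tower: the tree writes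
the `η`-lattice expressions on the finest torus `T^{(0)}` (spacing `ε = L^{−K}`), the paper's `ηG_k(x,x)` is `ε·(Σ_{i<k}G^η_{(i)})(x,x)`
(p18 g8's reading of graph (a)), and the limit is `k → ∞` (hence `K ≥ k → ∞`), uniformly in the volume; in `d = 2` the bound
`C·k·ε ≤ C·K·L^{−K}` is uniform in `k ≤ K`, so the literal reading `ε → 0` holds as well (`eps_mul_Gk_diag_tendsto_zero_two'`).

THE `d = 2` POWER COUNTING.  By (2.1)–(2.2) pp. 422–423 the class (3.21) has degree `D = [d + (2−d) − 1] + [d + (2−d)] − d = 3 − d`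
(graph (b); graph (a): `(d + 1) + (2 − d) − d`): `0` in `d = 3`, `1` in `d = 2`.  In `d = 2` the (2.10) piece bound at the diagonal is
`|G^η_{(j)}(x,x)| ≤ C` (NO power `(L^jη)^{2−d}`), so `|G^η_k(x,x)| ≤ C·k` — the `d = 2` logarithm `log(L^kη/η) = k·log L` — and
`|ηG^η_k(x,x)| ≤ C·k·η ≤ C·k·L^{−k} → 0`: the *"finite constant"* is `0` (compare p20 g4's free `d = 2` tadpole
`B3CxiTadpoleLimit.tendsto_xi_mul_Cxi_zero_two`, `ξ·C^ξ(0) → 0`).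

WHAT IS PROVED (all at `P.d = 2`, zero-field torus instance, `1 ≤ k ≤ K`; constants are functions of `L, a, m²` only — uniform in the
volume `(m, K)` and the scale `k`).
* §1 `gpiece_bounds_two` — the (2.10) piece bounds read in `d = 2` (exponents `2 − d = 0`, `1 − d = −1`).
* §2 `abs_Gk_diag_le_two` (`|G^η_k(x,x)| ≤ C·k`), **`eps_mul_abs_Gk_diag_le_two`** (`|ηG^η_k(x,x)| ≤ C·k·η ≤ C·k·L^{−k}`),
  **`eps_mul_Gk_diag_tendsto_zero_two`** (for every `e > 0` there is `k₀` with `|ηG^η_k(x,x)| < e` for every volume, every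
  `k₀ ≤ k ≤ K`, every site — the shape of p20 g8's `eps_mul_Gk_diag_tendsto`), `eps_mul_Gk_diag_tendsto_zero_two'` (`K₀ ≤ K`
  suffices, uniformly in `1 ≤ k ≤ K`), the dictionary `eps_mul_sum_gpiece_diag_two` (`ηG^η_k(x,x) = η·G^ξ_k(0;x,x)` in `d = 2`: p39's
  `G0xi` is `G^η_k` itself, the kernel carries no length dimension) with `eps_mul_G0xi_diag_tendsto_zero_two`, and graph (a) of (3.21):
  **`expr321a_zero_torus_two`** (a local vertex with coefficient `≤ C·k·η`), **`expr321a_zero_torus_tendsto_two`** (*"The expression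
  corresponding to the first graph is in fact convergent"*: `|expr321a[G^η_k]| ≤ e·Σ_μΣ_xη²‖φ(x)‖‖q²(∂^η_μφ′)(x)‖` from some `k₀` on —
  p20 g8's `expr321a_zero_torus_tendsto` with the limit vertex `K·g(x)`, `K = 0`).
HONEST SCOPE: the model instance `A = B̃ = 0`, `U ≡ 1`, `Ω` = the whole torus, `d = 2`, fixed `a > 0`, `m² ≥ 0`, odd `L > 1` (the scope
of every zero-torus file of rows B3.Eq2.10 / 3.11-3.17 / 3.21-3.24, with `3 ↦ 2`); constants existential; no rate beyond `C·k·η` is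
claimed and no lower bound (the true size `ηG_k(x,x) ≍ k·η` is not asserted); the full propagator `G_k(Ω,B̃)` at a non-zero
background needs (2.10) at the print's generality (row B3.Eq2.10, open).  D-0026: theorems only — no `def`, no named fact, no
`sorry`; standard axioms.  Unit `lit-balaban-p27-g30` (literature-prover-lit-balaban-p27-g30-0), HOME `run/shared/lean/pub/lit-balaban/`,
2026-08-22.
-/

open scoped BigOperators RealInnerProductSpace Topology
open Filter

namespace Literature.MathematicalPhysics.QuantumFieldTheory.Balaban1983to89.B3TadpoleZeroTorusTwoDim

open Finset LatticeFieldCalculus B3Sect3ScalarSelfEnergy B3Resummation315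
open B3Sect3KernelsZeroTorus B3GkZeroTorusRescaled B3Eq317ZeroTorus B3Eq322OneLegDifferentiated

noncomputable section

universe u

/-! ## §1 The (2.10) piece bounds of the zero-field torus tower read in `d = 2` -/

section Pieces

/-- **(2.10) p. 426 for the zero-field torus tower, `d = 2`**: for odd `L > 1`, `a > 0`, `m² ≥ 0` there are `δ, C > 0` with, for
every volume `P = (2, L, m, K)`, every `1 ≤ k ≤ K`, every piece `j` and all sites,
`|G^η_{(j)}(x,x′)| ≤ C·e^{−δ|x−x′|₁η/(L^jη)}` (the printed factor `(L^jη)^{−d+2}` is `1`) and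
`|(∂^η_μG^η_{(j)})(x,x′)| ≤ C·(L^jη)^{−1}·e^{−δ|x−x′|₁η/(L^jη)}` — p20 g5's `gpiece_bounds` at `d = 2`.
[cite: Balaban1983Higgs3, (2.10) p.426] -/
theorem gpiece_bounds_two (L : ℕ) (hL : Odd L ∧ 1 < L) {a : ℝ} (ha : 0 < a) {msq : ℝ} (hmsq : 0 ≤ msq) :
    ∃ δ C : ℝ, 0 < δ ∧ 0 < C ∧ ∀ (P : Params), P.d = 2 → P.L = L → ∀ k : ℕ, 1 ≤ k → k ≤ P.K →
      (∀ (j : ℕ) (x x' : Site P 0), |gpiece P a msq k j x x'| ≤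
          C * Real.exp (-(δ * (P.spacing j)⁻¹ * (P.eps * (Site.tdist x x' : ℝ))))) ∧
      (∀ (j : ℕ) (μ : Fin P.d) (x x' : Site P 0), |d1Kernel P.eps⁻¹ μ (gpiece P a msq k j) x x'| ≤
          C * (P.spacing j)⁻¹ * Real.exp (-(δ * (P.spacing j)⁻¹ * (P.eps * (Site.tdist x x' : ℝ))))) := by
  obtain ⟨δ, C, hδ, hC, HB⟩ := gpiece_bounds 2 L (by norm_num) hL ha hmsq
  refine ⟨δ, C, hδ, hC, fun P hPd hPL k hk1 hkK => ?_⟩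
  obtain ⟨hval, hrow, -, -⟩ := HB P hPd hPL k hk1 hkK
  have e0 : ((2 : ℝ) - ((P.d : ℕ) : ℝ)) = 0 := by rw [hPd]; norm_num
  have e1 : ((1 : ℝ) - ((P.d : ℕ) : ℝ)) = -1 := by rw [hPd]; norm_num
  refine ⟨fun j x x' => ?_, fun j μ x x' => ?_⟩
  · have h := hval j x x'
    rw [e0, Real.rpow_zero, mul_one] at h
    exact h
  · have h := hrow j μ x x'
    rw [e1, Real.rpow_neg_one] at h
    exact h

end Pieces

/-! ## §2 p. 438: "ηG_k(x,x) is convergent to some finite constant as η → 0" — `d = 2` (the constant is `0`) -/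

section Tadpole

/-- kernel: `ε = L^{−K} ≤ L^{−k}` for `k ≤ K`. [cite: Balaban1983Higgs3, (1.1) p.412] -/
theorem eps_le_inv_pow (P : Params) {k : ℕ} (hk : k ≤ P.K) : P.eps ≤ ((P.L : ℝ)⁻¹) ^ k := by
  unfold Params.eps
  exact pow_le_pow_of_le_one (inv_nonneg.mpr P.cast_L_pos.le)
    (inv_le_one_of_one_le₀ (by exact_mod_cast P.hL.2.le)) hk

/-- kernel: `k·L^{−k} → 0`, uniformly usable bound: for `θ > 0` there is `k₀` with `C·(k·L^{−k}) < θ` for all `k ≥ k₀` (`L > 1`).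
[folklore] -/
private theorem const_mul_self_mul_inv_pow_lt {L : ℕ} (hL : 1 < L) (C : ℝ) {θ : ℝ} (hθ : 0 < θ) :
    ∃ k₀ : ℕ, ∀ k : ℕ, k₀ ≤ k → C * ((k : ℝ) * ((L : ℝ)⁻¹) ^ k) < θ := by
  have hr0 : 0 ≤ ((L : ℝ))⁻¹ := inv_nonneg.mpr (Nat.cast_nonneg L)
  have hr1 : ((L : ℝ))⁻¹ < 1 := inv_lt_one_of_one_lt₀ (by exact_mod_cast hL)
  have ht : Tendsto (fun n : ℕ => C * ((n : ℝ) * ((L : ℝ)⁻¹) ^ n)) atTop (𝓝 0) := by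
    simpa using (tendsto_self_mul_const_pow_of_lt_one hr0 hr1).const_mul C
  obtain ⟨k₀, hk₀⟩ := eventually_atTop.mp (ht.eventually_lt_const hθ)
  exact ⟨k₀, hk₀⟩

/-- **`|G^η_k(x,x)| ≤ C·k` in `d = 2`** — the diagonal of the resummed zero-field torus tower `G^η_k = Σ_{j<k}G^η_{(j)}` grows at most
linearly in the number of scales (each piece is bounded by `C` at the diagonal; the `d = 2` logarithm `log(L^kη/η) = k·log L`), for
every volume `P = (2, L, m, K)`, every `1 ≤ k ≤ K` and every site. [cite: Balaban1983Higgs3, (3.21) p.438] -/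
theorem abs_Gk_diag_le_two (L : ℕ) (hL : Odd L ∧ 1 < L) {a : ℝ} (ha : 0 < a) {msq : ℝ} (hmsq : 0 ≤ msq) :
    ∃ C : ℝ, 0 < C ∧ ∀ (P : Params), P.d = 2 → P.L = L → ∀ k : ℕ, 1 ≤ k → k ≤ P.K → ∀ x : Site P 0,
      |(∑ i ∈ range k, gpiece P a msq k i) x x| ≤ C * k := by
  obtain ⟨δ, C, hδ, hC, HB⟩ := gpiece_bounds_two L hL ha hmsq
  refine ⟨C, hC, fun P hPd hPL k hk1 hkK x => ?_⟩
  obtain ⟨hval, -⟩ := HB P hPd hPL k hk1 hkK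
  rw [sum_gpiece_apply]
  have hterm : ∀ i : ℕ, |gpiece P a msq k i x x| ≤ C := fun i => by
    refine (hval i x x).trans (mul_le_of_le_one_right hC.le (Real.exp_le_one_iff.mpr ?_))
    have h1 : 0 < P.spacing i := P.spacing_pos i
    have h2 : 0 < P.eps := P.eps_pos
    have h3 : (0 : ℝ) ≤ (Site.tdist x x : ℝ) := Nat.cast_nonneg _
    have : 0 ≤ δ * (P.spacing i)⁻¹ * (P.eps * (Site.tdist x x : ℝ)) := by positivity
    linarith
  calc |∑ i ∈ range k, gpiece P a msq k i x x| ≤ ∑ i ∈ range k, |gpiece P a msq k i x x| := abs_sum_le_sum_abs _ _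
    _ ≤ ∑ _i ∈ range k, C := sum_le_sum fun i _ => hterm i
    _ = C * k := by rw [sum_const, card_range, nsmul_eq_mul, mul_comm]

/-- **p. 438, `d = 2`: `|ηG_k(x,x)| ≤ C·k·η`** — the loop factor of the first graph of (3.21) on the resummed zero-field torus tower
(p18 g8's reading `ε·(Σ_{i<k}G^η_{(i)})(x,x)`), for every volume `P = (2, L, m, K)`, every `1 ≤ k ≤ K`, every site; since
`η = L^{−K} ≤ L^{−k}`, also `≤ C·k·L^{−k}`. [cite: Balaban1983Higgs3, (3.21) p.438] -/
theorem eps_mul_abs_Gk_diag_le_two (L : ℕ) (hL : Odd L ∧ 1 < L) {a : ℝ} (ha : 0 < a) {msq : ℝ} (hmsq : 0 ≤ msq) :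
    ∃ C : ℝ, 0 < C ∧ ∀ (P : Params), P.d = 2 → P.L = L → ∀ k : ℕ, 1 ≤ k → k ≤ P.K → ∀ x : Site P 0,
      |P.eps * (∑ i ∈ range k, gpiece P a msq k i) x x| ≤ C * (k * P.eps) ∧
      |P.eps * (∑ i ∈ range k, gpiece P a msq k i) x x| ≤ C * (k * ((L : ℝ)⁻¹) ^ k) := by
  obtain ⟨C, hC, H⟩ := abs_Gk_diag_le_two L hL ha hmsq
  refine ⟨C, hC, fun P hPd hPL k hk1 hkK x => ?_⟩
  have hε : 0 < P.eps := P.eps_pos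
  have h1 : |P.eps * (∑ i ∈ range k, gpiece P a msq k i) x x| ≤ C * (k * P.eps) := by
    rw [abs_mul, abs_of_pos hε]
    calc P.eps * |(∑ i ∈ range k, gpiece P a msq k i) x x| ≤ P.eps * (C * k) :=
          mul_le_mul_of_nonneg_left (H P hPd hPL k hk1 hkK x) hε.le
      _ = C * (k * P.eps) := by ring
  refine ⟨h1, h1.trans ?_⟩
  have h2 : P.eps ≤ ((L : ℝ)⁻¹) ^ k := by rw [← hPL]; exact eps_le_inv_pow P hkK
  have hk0 : (0 : ℝ) ≤ k := Nat.cast_nonneg k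
  exact mul_le_mul_of_nonneg_left (mul_le_mul_of_nonneg_left h2 hk0) hC.le

/-- **p. 438 "ηG_k(x,x) is convergent to some finite constant as η → 0" AT THE ZERO-FIELD TORUS INSTANCE, `d = 2`, uniformly in the
volume — the constant is `0`**: for odd `L > 1`, `a > 0`, `m² ≥ 0` and every `e > 0` there is `k₀` such that for EVERY volume
`P = (2, L, m, K)`, every `k₀ ≤ k ≤ K` (`1 ≤ k`) and every site `x`: `|ε·(Σ_{i<k}G^η_{(i)})(x,x)| < e` (the shape of p20 g8's `d = 3`
`eps_mul_Gk_diag_tendsto`, whose limit is the non-zero `K₃`). [cite: Balaban1983Higgs3, (3.21) p.438] -/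
theorem eps_mul_Gk_diag_tendsto_zero_two (L : ℕ) (hL : Odd L ∧ 1 < L) {a : ℝ} (ha : 0 < a) {msq : ℝ} (hmsq : 0 ≤ msq)
    {e : ℝ} (he : 0 < e) :
    ∃ k₀ : ℕ, ∀ (P : Params), P.d = 2 → P.L = L → ∀ k : ℕ, k₀ ≤ k → 1 ≤ k → k ≤ P.K → ∀ x : Site P 0,
      |P.eps * (∑ i ∈ range k, gpiece P a msq k i) x x| < e := by
  obtain ⟨C, hC, H⟩ := eps_mul_abs_Gk_diag_le_two L hL ha hmsq
  obtain ⟨k₀, hk₀⟩ := const_mul_self_mul_inv_pow_lt hL.2 C he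
  exact ⟨k₀, fun P hPd hPL k hk0 hk1 hkK x => ((H P hPd hPL k hk1 hkK x).2).trans_lt (hk₀ k hk0)⟩

/-- **The literal reading "as η → 0", `d = 2`**: `η = L^{−K}` is the finest spacing, and the bound `C·k·η ≤ C·K·L^{−K}` is uniform in
the scale `k ≤ K`; so for every `e > 0` there is `K₀` such that for every volume with `K ≥ K₀`, EVERY `1 ≤ k ≤ K` and every site,
`|ηG_k(x,x)| < e`. [cite: Balaban1983Higgs3, (3.21) p.438] -/
theorem eps_mul_Gk_diag_tendsto_zero_two' (L : ℕ) (hL : Odd L ∧ 1 < L) {a : ℝ} (ha : 0 < a) {msq : ℝ} (hmsq : 0 ≤ msq)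
    {e : ℝ} (he : 0 < e) :
    ∃ K₀ : ℕ, ∀ (P : Params), P.d = 2 → P.L = L → K₀ ≤ P.K → ∀ k : ℕ, 1 ≤ k → k ≤ P.K → ∀ x : Site P 0,
      |P.eps * (∑ i ∈ range k, gpiece P a msq k i) x x| < e := by
  obtain ⟨C, hC, H⟩ := eps_mul_abs_Gk_diag_le_two L hL ha hmsq
  obtain ⟨K₀, hK₀⟩ := const_mul_self_mul_inv_pow_lt hL.2 C he
  refine ⟨K₀, fun P hPd hPL hK0 k hk1 hkK x => ((H P hPd hPL k hk1 hkK x).1).trans_lt ?_⟩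
  have hε : P.eps = ((L : ℝ)⁻¹) ^ P.K := by unfold Params.eps; rw [hPL]
  have hkK' : (k : ℝ) ≤ P.K := by exact_mod_cast hkK
  calc C * (k * P.eps) ≤ C * (P.K * P.eps) :=
        mul_le_mul_of_nonneg_left (mul_le_mul_of_nonneg_right hkK' P.eps_pos.le) hC.le
    _ = C * ((P.K : ℝ) * ((L : ℝ)⁻¹) ^ P.K) := by rw [hε]
    _ < e := hK₀ P.K hK0

variable {P : Params}

/-- **The dictionary with p39 g6's rescaled propagator, `d = 2`**: `ε·G^η_k(x,x) = ε·G^ξ_k(0;x,x)` — in `d = 2` the kernel is not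
rescaled (`G^ξ_k(0) = (L^kε)^{d−2}·G^η_k = G^η_k`), only the lattice spacing is (compare p18 g8's `d = 3` identity
`ε·G^η_k(x,x) = ξ·G^ξ_k(0;x,x)`). [cite: Balaban1983Higgs3, (3.16) p.437, (3.21) p.438] -/
theorem eps_mul_sum_gpiece_diag_two {a msq : ℝ} (ha : 0 < a) (hm : 0 ≤ msq) (hd : P.d = 2) {k : ℕ} (hk : 1 ≤ k)
    (x : Site P 0) :
    P.eps * (∑ i ∈ range k, gpiece P a msq k i) x x = P.eps * G0xi P a msq k x x := by
  rw [G0xi_eq_rescaled ha hm (by omega) hk, hd]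
  simp

/-- **p. 438 in p39's rescaled units, `d = 2`**: `ε·G^ξ_k(0;y,y) → 0` as `k → ∞`, uniformly in the volume: for every `e > 0` there is
`k₀` with `|ε·G^ξ_k(0;y,y)| < e` for every volume `P = (2, L, m, K)`, every `k₀ ≤ k ≤ K`, every site.
[cite: Balaban1983Higgs3, (3.21) p.438] -/
theorem eps_mul_G0xi_diag_tendsto_zero_two (L : ℕ) (hL : Odd L ∧ 1 < L) {a : ℝ} (ha : 0 < a) {msq : ℝ} (hmsq : 0 ≤ msq)
    {e : ℝ} (he : 0 < e) :
    ∃ k₀ : ℕ, ∀ (P : Params), P.d = 2 → P.L = L → ∀ k : ℕ, k₀ ≤ k → 1 ≤ k → k ≤ P.K → ∀ y : Site P 0,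
      |P.eps * G0xi P a msq k y y| < e := by
  obtain ⟨k₀, H⟩ := eps_mul_Gk_diag_tendsto_zero_two L hL ha hmsq he
  refine ⟨k₀, fun P hPd hPL k hk0 hk1 hkK y => ?_⟩
  rw [← eps_mul_sum_gpiece_diag_two ha hmsq hPd hk1 y]
  exact H P hPd hPL k hk0 hk1 hkK y

/-- **(3.21) p. 438, the FIRST graph AT THE ZERO-FIELD TORUS MODEL INSTANCE, `d = 2`** (p18 g8's `expr321a_zero_torus` at `d = 2`):
for odd `L > 1`, `a > 0`, `m² ≥ 0` there is `C > 0` such that for EVERY volume `P = (2,L,m,K)`, every `1 ≤ k ≤ K` and all `q`,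
`|g| ≤ 1`, `φ`, `φ′`: (i) the expressions on the pieces `G^η_{(i)}` sum to the expression on `G^η_k = Σ_{i<k}G^η_{(i)}`, and (ii)
`|expr321a[G^η_k]| ≤ C·k·η·Σ_μΣ_xη²‖φ(x)‖‖q²(∂^η_μφ′)(x)‖` — a local vertex whose coefficient `ηG_k(x,x)g(x)` is `O(k·η)`.
[cite: Balaban1983Higgs3, (3.21) p.438] -/
theorem expr321a_zero_torus_two (L : ℕ) (hL : Odd L ∧ 1 < L) {a : ℝ} (ha : 0 < a) {msq : ℝ} (hmsq : 0 ≤ msq) :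
    ∃ C : ℝ, 0 < C ∧ ∀ (P : Params), P.d = 2 → P.L = L → ∀ k : ℕ, 1 ≤ k → k ≤ P.K →
      ∀ {W : Type u} [NormedAddCommGroup W] [InnerProductSpace ℝ W] (q : W →ₗ[ℝ] W) (g : SiteField P 0 ℝ)
        (φ φ' : SiteField P 0 W), (∀ x, |g x| ≤ 1) →
        (∑ i ∈ range k, expr321a P.eps q (gpiece P a msq k i) g φ φ' =
            expr321a P.eps q (∑ i ∈ range k, gpiece P a msq k i) g φ φ') ∧
        |expr321a P.eps q (∑ i ∈ range k, gpiece P a msq k i) g φ φ'| ≤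
          C * (k * P.eps) * ∑ μ : Fin P.d, ∑ x : Site P 0, P.eps ^ P.d * (‖φ x‖ * ‖q (q (pdiff P.eps⁻¹ μ φ' x))‖) := by
  obtain ⟨C, hC, H⟩ := eps_mul_abs_Gk_diag_le_two L hL ha hmsq
  refine ⟨C, hC, fun P hPd hPL k hk1 hkK W _ _ q g φ φ' hg => ⟨?_, ?_⟩⟩
  · exact (expr321a_finset_sum (range k) P.eps q (fun i => gpiece P a msq k i) g φ φ').symm
  · refine abs_expr321a_le P.eps_pos.le q _ g (fun x => ?_) φ φ'
    have hdiag := (H P hPd hPL k hk1 hkK x).1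
    have hC0 : 0 ≤ C * (k * P.eps) := by have := P.eps_pos; positivity
    rw [abs_mul]
    calc |P.eps * (∑ i ∈ range k, gpiece P a msq k i) x x| * |g x| ≤ C * (k * P.eps) * 1 :=
          mul_le_mul hdiag (hg x) (abs_nonneg _) hC0
      _ = C * (k * P.eps) := mul_one _

/-- **p. 438, "The expression corresponding to the first graph is in fact convergent, because ηG_k(x,x) is convergent to some
finite constant as η → 0" — `d = 2`, zero-field torus instance, uniformly in the volume** (p20 g8's `expr321a_zero_torus_tendsto` at
`d = 2`, where the limit vertex `K·g(x)` has `K = 0`): for every `e > 0` there is `k₀` such that for every volume `P = (2, L, m, K)`,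
every `k₀ ≤ k ≤ K`, every `q`, `|g| ≤ 1`, `φ`, `φ′`: `|expr321a[G^η_k]| ≤ e·Σ_μΣ_xη²‖φ(x)‖‖q²(∂^η_μφ′)(x)‖`.
[cite: Balaban1983Higgs3, (3.21) p.438] -/
theorem expr321a_zero_torus_tendsto_two (L : ℕ) (hL : Odd L ∧ 1 < L) {a : ℝ} (ha : 0 < a) {msq : ℝ} (hmsq : 0 ≤ msq)
    {e : ℝ} (he : 0 < e) :
    ∃ k₀ : ℕ, ∀ (P : Params), P.d = 2 → P.L = L → ∀ k : ℕ, k₀ ≤ k → 1 ≤ k → k ≤ P.K →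
      ∀ {W : Type u} [NormedAddCommGroup W] [InnerProductSpace ℝ W] (q : W →ₗ[ℝ] W) (g : SiteField P 0 ℝ)
        (φ φ' : SiteField P 0 W), (∀ x, |g x| ≤ 1) →
        |expr321a P.eps q (∑ i ∈ range k, gpiece P a msq k i) g φ φ'| ≤
          e * ∑ μ : Fin P.d, ∑ x : Site P 0, P.eps ^ P.d * (‖φ x‖ * ‖q (q (pdiff P.eps⁻¹ μ φ' x))‖) := by
  obtain ⟨k₀, H⟩ := eps_mul_Gk_diag_tendsto_zero_two L hL ha hmsq he
  refine ⟨k₀, fun P hPd hPL k hk0 hk1 hkK W _ _ q g φ φ' hg => ?_⟩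
  refine abs_expr321a_le P.eps_pos.le q _ g (fun x => ?_) φ φ'
  rw [abs_mul]
  calc |P.eps * (∑ i ∈ range k, gpiece P a msq k i) x x| * |g x| ≤ e * 1 :=
        mul_le_mul (H P hPd hPL k hk0 hk1 hkK x).le (hg x) (abs_nonneg _) he.le
    _ = e := mul_one e

end Tadpole

end

end Literature.MathematicalPhysics.QuantumFieldTheory.Balaban1983to89.B3TadpoleZeroTorusTwoDim
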